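import Mathlib

/-!
# Meridians of torus knots are weight elements (solo informed, s32, C462)

Abstract group-theoretic core of the remark used in the (Q-sym″) analysis of HKM24 Q1.4
(`work/s32/structureII.md` §11.6, claim C462): in the torus-knot group `⟨x, y | x^p = y^q⟩`
with `q = p*c + 1`, the element `μ = x * (y^c)⁻¹` (the meridian of `T(p,q)`, e.g. `x*y⁻³` for
`T(2,7)`) normally generates the whole group.  Consequently every element of linking number `k`
is a product of conjugates of `μ^{±1}` with exponent sum `k`, which is what makes the class
condition in (Q-sym″) unobstructed.

We prove the statement for an arbitrary group generated by `x, y` satisfying the relation, so it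
applies verbatim to the presented group and to `π₁(S³ ∖ T(p,q))`.
-/

namespace Summit.SmoothPoincare4.SmoothPoincare4.Theorems

open Subgroup

/-- In a group generated by `x, y` with `x ^ p = y ^ q` and `q = p * c + 1`, the normal closure of
`x * (y ^ c)⁻¹` is everything. -/
theorem SoloInformed_torusKnot_meridian_weight {G : Type*} [Group G] (x y : G) (p q c : ℕ)
    (hq : q = p * c + 1) (hrel : x ^ p = y ^ q)
    (hgen : Subgroup.closure ({x, y} : Set G) = ⊤) :
    Subgroup.normalClosure ({x * (y ^ c)⁻¹} : Set G) = ⊤ := by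
  set N : Subgroup G := Subgroup.normalClosure ({x * (y ^ c)⁻¹} : Set G) with hN
  haveI : N.Normal := Subgroup.normalClosure_normal
  -- work in the quotient `G ⧸ N`
  have hμ : x * (y ^ c)⁻¹ ∈ N := Subgroup.subset_normalClosure (Set.mem_singleton _)
  have hab : (QuotientGroup.mk x : G ⧸ N) = (QuotientGroup.mk y : G ⧸ N) ^ c := by
    have h1 : (QuotientGroup.mk (x * (y ^ c)⁻¹) : G ⧸ N) = 1 :=
      (QuotientGroup.eq_one_iff _).mpr hμ
    rw [QuotientGroup.mk_mul, QuotientGroup.mk_inv, QuotientGroup.mk_pow,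
      mul_inv_eq_one] at h1
    exact h1
  have hpq : ((QuotientGroup.mk x : G ⧸ N)) ^ p = (QuotientGroup.mk y : G ⧸ N) ^ q := by
    rw [← QuotientGroup.mk_pow, ← QuotientGroup.mk_pow, hrel]
  have hb : (QuotientGroup.mk y : G ⧸ N) = 1 := by
    set b : G ⧸ N := QuotientGroup.mk y with hb'
    have h2 : b ^ (p * c) * b = b ^ (p * c) * 1 := by
      rw [mul_one, ← pow_succ, ← hq, ← hpq, hab, ← pow_mul, Nat.mul_comm]
    exact mul_left_cancel h2
  have ha : (QuotientGroup.mk x : G ⧸ N) = 1 := by rw [hab, hb, one_pow]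
  have hx : x ∈ N := (QuotientGroup.eq_one_iff _).mp ha
  have hy : y ∈ N := (QuotientGroup.eq_one_iff _).mp hb
  have hle : Subgroup.closure ({x, y} : Set G) ≤ N := by
    rw [Subgroup.closure_le]
    intro z hz
    simp only [Set.mem_insert_iff, Set.mem_singleton_iff] at hz
    rcases hz with rfl | rfl
    · exact hx
    · exact hy
  rw [hgen] at hle
  exact top_le_iff.mp hle

/-- `T(2,7)`: in `⟨x, y | x² = y⁷⟩` the meridian `x * (y^3)⁻¹` is a weight element. -/
theorem SoloInformed_T27_meridian_weight {G : Type*} [Group G] (x y : G)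
    (hrel : x ^ 2 = y ^ 7) (hgen : Subgroup.closure ({x, y} : Set G) = ⊤) :
    Subgroup.normalClosure ({x * (y ^ 3)⁻¹} : Set G) = ⊤ :=
  SoloInformed_torusKnot_meridian_weight x y 2 7 3 (by norm_num) hrel hgen

/-- `T(3,7)`: in `⟨x, y | x³ = y⁷⟩` the meridian `x * (y^2)⁻¹` is a weight element. -/
theorem SoloInformed_T37_meridian_weight {G : Type*} [Group G] (x y : G)
    (hrel : x ^ 3 = y ^ 7) (hgen : Subgroup.closure ({x, y} : Set G) = ⊤) :
    Subgroup.normalClosure ({x * (y ^ 2)⁻¹} : Set G) = ⊤ :=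
  SoloInformed_torusKnot_meridian_weight x y 3 7 2 (by norm_num) hrel hgen

/-- `T(2,3)`: in `⟨x, y | x² = y³⟩` the meridian `x * (y^1)⁻¹` is a weight element. -/
theorem SoloInformed_T23_meridian_weight {G : Type*} [Group G] (x y : G)
    (hrel : x ^ 2 = y ^ 3) (hgen : Subgroup.closure ({x, y} : Set G) = ⊤) :
    Subgroup.normalClosure ({x * (y ^ 1)⁻¹} : Set G) = ⊤ :=
  SoloInformed_torusKnot_meridian_weight x y 2 3 1 (by norm_num) hrel hgen

end Summit.SmoothPoincare4.SmoothPoincare4.Theorems
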